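import Mathlib
import Literature.Analysis.FunctionSpaces.MinlosSazonovBound
import Summits.RiemannHypothesis.RiemannHypothesis.Theorems.PfPersistenceF2PlantedIndex

/-!
# F2 / SPLIT-MICRO — the deflation floor of a split surgery (G-SPLIT certificate lemma)

pub-rhpf fake seat 2, generation 5.  **Mechanism / rigidity campaign; no RH claims.**  Elementary and RH-free
linear algebra; it is the "deflation lemma" that rulings A171 (A3) / A173 (A3) of the cell's ADJ-LOG accepted as
"elementary, in text" for the SPLIT-MICRO certificates (FAKES.md §2.8, §2.8.5; GAP-CLASSES.md row G-SPLIT), now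
kernel-checked so that those certificate sentences are DERIVED over tree declarations by name.

OBJECT.  The served L-datum `displaced {"mode":"split","n":…,"delta":η}` replaces a critical zero `½ + iγ` of ζ by the
off-line pair `½ ± η + iγ`.  On either parity block of the windowed Weil form (window `[-a,a]`, rank `N`) this is the
rank-three surgery
`Q_split = Q_ζ + 4 p pᵀ − 4 q qᵀ − 2 p₀ p₀ᵀ`
(`p₀` = the zero's test vector at `η = 0`, `p`, `q` = real and imaginary parts of the displaced test vector; all
certified DATA in the cell).  Writing `d := p − p₀` one has the identity
`4⟨p,x⟩² − 2⟨p₀,x⟩² + 4⟨d,x⟩² = 2⟨p + d, x⟩²` (`split_identity`), hence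
`Q_split ⪰ Q_ζ − 4 d dᵀ − 4 q qᵀ` (`splitForm_ge`): the surgery can lower the form only through the RANK-TWO DEFICIT
spanned by `d = O(η²)` and `q = O(η)`.

DEFLATION FLOOR (`deflation_floor`, `deflation_floor_of_floor`).  For `A ⪰ 0`, weights `c_i ≥ 0` and trial
preimages `y_i` (think `y_i = A⁻¹ b_i`), Cauchy–Schwarz in the `A`-form gives
`xᵀAx − Σ c_i ⟨A y_i, x⟩² ≥ (1 − τ) xᵀAx`, `τ := Σ c_i ⟨y_i, A y_i⟩` (= `Σ c_i b_iᵀA⁻¹b_i`, the Schur-complement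
weight); no inverse appears in this form, so it applies verbatim to interval preimages.  Consequences used by the cell:
* `split_floor` / `split_eigenvalue_ge`: with `Q_ζ y_d = d`, `Q_ζ y_q = q`, `τ = 4⟨y_d,Q_ζ y_d⟩ + 4⟨y_q,Q_ζ y_q⟩ ≤ 1`
  and a spectral floor `ε|x|² ≤ xᵀQ_ζx`, EVERY eigenvalue of `Q_split` is `≥ (1 − τ) ε` — the certified-positive odd
  sector of `split-certify-j063236.json` (`τ⁻ = 9.727e-4`, `ε₁⁻(SPLIT) ≥ 0.999027 ε₁⁻(ζ)`);
* `one_lt_tau_of_split_neg` / `one_lt_tau_of_multiSplit_neg`: a split block (or any finite superposition of split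
  surgeries on one parity block) that is negative somewhere has deficit weight `τ > 1` — the NECESSARY CONDITION behind the
  resolution-wall row G-SPLIT (`η ≥ η*`) and the E-D R-TOP obstruction of FAKES.md §2.9.
All statements are over an arbitrary finite index type; `Matrix.PosSemidef` is Mathlib's.
-/

namespace Summit.RiemannHypothesis.RiemannHypothesis.Theorems.PfPersistenceF2SplitDeflation

open Matrix BigOperators Finset
open Literature.Analysis.FunctionSpaces.MinlosSazonov (sq_dotProduct_mulVec_le dotProduct_mulVec_comm)
open Summit.RiemannHypothesis.RiemannHypothesis.Theorems.PfPersistenceF2PlantedIndex (vecMulVec_mulVec_eq)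

variable {ι : Type*} [Fintype ι]

section Deflation

/-- The form of a real positive semidefinite matrix is nonnegative (Mathlib's `PosSemidef`, `star` trivial). -/
theorem form_nonneg {A : Matrix ι ι ℝ} (hA : A.PosSemidef) (x : ι → ℝ) : 0 ≤ x ⬝ᵥ A *ᵥ x := by
  simpa using hA.dotProduct_mulVec_nonneg x

/-- Constructor matching the cell's certified hypotheses (`Q.IsSymm` and `∀ v, 0 ≤ vᵀQv`, as in
`PfPersistenceF2RealPairNodal`): such a real matrix is `PosSemidef` in Mathlib's sense. -/
theorem posSemidef_of_isSymm {A : Matrix ι ι ℝ} (hS : A.IsSymm) (h : ∀ v, 0 ≤ v ⬝ᵥ A *ᵥ v) :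
    A.PosSemidef :=
  PosSemidef.of_dotProduct_mulVec_nonneg
    (by rw [IsHermitian, conjTranspose_eq_transpose_of_trivial]; exact hS) (fun x => by simpa using h x)

/-- One deflation term: `c ⟨A y, x⟩² ≤ c ⟨y, A y⟩ ⟨x, A x⟩` for `c ≥ 0`, `A ⪰ 0` (Cauchy–Schwarz in the `A`-form).
[folklore] -/
theorem deflation_term_le {A : Matrix ι ι ℝ} (hA : A.PosSemidef) {c : ℝ} (hc : 0 ≤ c) (y x : ι → ℝ) :
    c * ((A *ᵥ y) ⬝ᵥ x) ^ 2 ≤ c * (y ⬝ᵥ A *ᵥ y) * (x ⬝ᵥ A *ᵥ x) := by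
  have h1 : (A *ᵥ y) ⬝ᵥ x = y ⬝ᵥ A *ᵥ x := by
    rw [dotProduct_comm, dotProduct_mulVec_comm hA.1 x y]
  rw [h1, mul_assoc]
  exact mul_le_mul_of_nonneg_left (sq_dotProduct_mulVec_le hA y x) hc

/-- `deflation_term_le` with the image vector named: `A y = b ⇒ c⟨b,x⟩² ≤ c⟨y,Ay⟩⟨x,Ax⟩`. [folklore] -/
theorem deflation_term_le_of_eq {A : Matrix ι ι ℝ} (hA : A.PosSemidef) {c : ℝ} (hc : 0 ≤ c) {y b : ι → ℝ}
    (hb : A *ᵥ y = b) (x : ι → ℝ) :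
    c * (b ⬝ᵥ x) ^ 2 ≤ c * (y ⬝ᵥ A *ᵥ y) * (x ⬝ᵥ A *ᵥ x) := by
  subst hb
  exact deflation_term_le hA hc y x

/-- **Rank-`k` deflation floor.**  For `A ⪰ 0`, weights `c_i ≥ 0`, trial preimages `y_i` and
`τ := Σ c_i ⟨y_i, A y_i⟩`:  `(1 − τ) xᵀAx ≤ xᵀAx − Σ c_i ⟨A y_i, x⟩²` for every `x`.
With `b_i := A y_i` this reads `A − Σ c_i b_i b_iᵀ ⪰ (1 − Σ c_i b_iᵀ A⁻¹ b_i) A` (Schur complement / Cauchy–Schwarz);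
no inverse is needed in this form. [folklore] -/
theorem deflation_floor {A : Matrix ι ι ℝ} (hA : A.PosSemidef) {k : ℕ} (c : Fin k → ℝ) (hc : ∀ i, 0 ≤ c i)
    (y : Fin k → ι → ℝ) (x : ι → ℝ) :
    (1 - ∑ i, c i * (y i ⬝ᵥ A *ᵥ y i)) * (x ⬝ᵥ A *ᵥ x)
      ≤ x ⬝ᵥ A *ᵥ x - ∑ i, c i * ((A *ᵥ y i) ⬝ᵥ x) ^ 2 := by
  have h : ∑ i, c i * ((A *ᵥ y i) ⬝ᵥ x) ^ 2 ≤ ∑ i, c i * (y i ⬝ᵥ A *ᵥ y i) * (x ⬝ᵥ A *ᵥ x) :=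
    Finset.sum_le_sum fun i _ => deflation_term_le hA (hc i) (y i) x
  rw [← Finset.sum_mul] at h
  have e : (1 - ∑ i, c i * (y i ⬝ᵥ A *ᵥ y i)) * (x ⬝ᵥ A *ᵥ x)
      = x ⬝ᵥ A *ᵥ x - (∑ i, c i * (y i ⬝ᵥ A *ᵥ y i)) * (x ⬝ᵥ A *ᵥ x) := by ring
  rw [e]
  linarith

/-- Deflation floor from a spectral floor: if `ε|x|² ≤ xᵀAx` for all `x` and `τ ≤ 1`, then
`(1 − τ) ε |x|² ≤ xᵀAx − Σ c_i ⟨A y_i, x⟩²`. [folklore] -/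
theorem deflation_floor_of_floor {A : Matrix ι ι ℝ} (hA : A.PosSemidef) {k : ℕ} (c : Fin k → ℝ)
    (hc : ∀ i, 0 ≤ c i) (y : Fin k → ι → ℝ) {ε : ℝ} (hε : ∀ x, ε * (x ⬝ᵥ x) ≤ x ⬝ᵥ A *ᵥ x)
    (hτ : ∑ i, c i * (y i ⬝ᵥ A *ᵥ y i) ≤ 1) (x : ι → ℝ) :
    (1 - ∑ i, c i * (y i ⬝ᵥ A *ᵥ y i)) * ε * (x ⬝ᵥ x)
      ≤ x ⬝ᵥ A *ᵥ x - ∑ i, c i * ((A *ᵥ y i) ⬝ᵥ x) ^ 2 := by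
  have h1 := deflation_floor hA c hc y x
  have h2 : (1 - ∑ i, c i * (y i ⬝ᵥ A *ᵥ y i)) * (ε * (x ⬝ᵥ x))
      ≤ (1 - ∑ i, c i * (y i ⬝ᵥ A *ᵥ y i)) * (x ⬝ᵥ A *ᵥ x) :=
    mul_le_mul_of_nonneg_left (hε x) (by linarith)
  calc (1 - ∑ i, c i * (y i ⬝ᵥ A *ᵥ y i)) * ε * (x ⬝ᵥ x)
        = (1 - ∑ i, c i * (y i ⬝ᵥ A *ᵥ y i)) * (ε * (x ⬝ᵥ x)) := by ring
    _ ≤ _ := h2.trans h1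

/-- Contrapositive (the shape of the cell's NO-GO statements): if `A ⪰ 0` and the deflated form
`xᵀAx − Σ c_i⟨A y_i, x⟩²` is negative at some `x`, then the deficit weight exceeds one: `1 < τ`. [folklore] -/
theorem one_lt_tau_of_deflated_neg {A : Matrix ι ι ℝ} (hA : A.PosSemidef) {k : ℕ} (c : Fin k → ℝ)
    (hc : ∀ i, 0 ≤ c i) (y : Fin k → ι → ℝ) {x : ι → ℝ}
    (hneg : x ⬝ᵥ A *ᵥ x - ∑ i, c i * ((A *ᵥ y i) ⬝ᵥ x) ^ 2 < 0) :
    1 < ∑ i, c i * (y i ⬝ᵥ A *ᵥ y i) := by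
  by_contra h
  push Not at h
  have h1 := deflation_floor hA c hc y x
  have h0 : 0 ≤ (1 - ∑ i, c i * (y i ⬝ᵥ A *ᵥ y i)) * (x ⬝ᵥ A *ᵥ x) :=
    mul_nonneg (by linarith) (form_nonneg hA x)
  linarith

end Deflation

section Split

/-- The split-surgery identity: with `d := p − p₀`, `4⟨p,x⟩² − 2⟨p₀,x⟩² + 4⟨d,x⟩² = 2⟨p + d, x⟩²`. -/
theorem split_identity (p p₀ x : ι → ℝ) :
    4 * (p ⬝ᵥ x) ^ 2 - 2 * (p₀ ⬝ᵥ x) ^ 2 + 4 * ((p - p₀) ⬝ᵥ x) ^ 2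
      = 2 * ((p + (p - p₀)) ⬝ᵥ x) ^ 2 := by
  rw [add_dotProduct, sub_dotProduct]
  ring

/-- **Split-surgery lower bound**: `xᵀQx − 4⟨p − p₀, x⟩² − 4⟨q, x⟩² ≤ xᵀQx + 4⟨p,x⟩² − 4⟨q,x⟩² − 2⟨p₀,x⟩²`
(drop the nonnegative term `2⟨p + d, x⟩²` of `split_identity`): the surgery lowers the form only through the
rank-two deficit spanned by `d = p − p₀` and `q`. -/
theorem splitForm_ge (Q : Matrix ι ι ℝ) (p q p₀ x : ι → ℝ) :
    x ⬝ᵥ Q *ᵥ x - 4 * ((p - p₀) ⬝ᵥ x) ^ 2 - 4 * (q ⬝ᵥ x) ^ 2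
      ≤ x ⬝ᵥ Q *ᵥ x + 4 * (p ⬝ᵥ x) ^ 2 - 4 * (q ⬝ᵥ x) ^ 2 - 2 * (p₀ ⬝ᵥ x) ^ 2 := by
  nlinarith [split_identity p p₀ x, sq_nonneg ((p + (p - p₀)) ⬝ᵥ x)]

/-- Quadratic form of the split-surgery block `Q + 4ppᵀ − 4qqᵀ − 2p₀p₀ᵀ`. -/
theorem dotProduct_splitMatrix_mulVec (Q : Matrix ι ι ℝ) (p q p₀ x : ι → ℝ) :
    x ⬝ᵥ (Q + (4 : ℝ) • vecMulVec p p - (4 : ℝ) • vecMulVec q q - (2 : ℝ) • vecMulVec p₀ p₀) *ᵥ x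
      = x ⬝ᵥ Q *ᵥ x + 4 * (p ⬝ᵥ x) ^ 2 - 4 * (q ⬝ᵥ x) ^ 2 - 2 * (p₀ ⬝ᵥ x) ^ 2 := by
  rw [sub_mulVec, sub_mulVec, add_mulVec, Matrix.smul_mulVec, Matrix.smul_mulVec, Matrix.smul_mulVec,
    vecMulVec_mulVec_eq, vecMulVec_mulVec_eq, vecMulVec_mulVec_eq, dotProduct_sub, dotProduct_sub,
    dotProduct_add, dotProduct_smul, dotProduct_smul, dotProduct_smul, dotProduct_smul, dotProduct_smul,
    dotProduct_smul, dotProduct_comm x p, dotProduct_comm x q, dotProduct_comm x p₀]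
  simp only [smul_eq_mul]
  ring

/-- **G-SPLIT certificate lemma (deflation floor of the split surgery).**  `Q ⪰ 0` with spectral floor `ε`
(`ε|x|² ≤ xᵀQx`), trial preimages `y_d`, `y_q` with `Q y_d = p − p₀`, `Q y_q = q`, and deficit weight
`τ := 4⟨y_d, Q y_d⟩ + 4⟨y_q, Q y_q⟩ ≤ 1`.  Then `(1 − τ) ε |x|² ≤ xᵀ(Q + 4ppᵀ − 4qqᵀ − 2p₀p₀ᵀ)x` for every `x`. -/
theorem split_floor {Q : Matrix ι ι ℝ} (hQ : Q.PosSemidef) (p q p₀ y_d y_q : ι → ℝ)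
    (hd : Q *ᵥ y_d = p - p₀) (hq : Q *ᵥ y_q = q) {ε : ℝ} (hε : ∀ x, ε * (x ⬝ᵥ x) ≤ x ⬝ᵥ Q *ᵥ x)
    (hτ : 4 * (y_d ⬝ᵥ Q *ᵥ y_d) + 4 * (y_q ⬝ᵥ Q *ᵥ y_q) ≤ 1) (x : ι → ℝ) :
    (1 - (4 * (y_d ⬝ᵥ Q *ᵥ y_d) + 4 * (y_q ⬝ᵥ Q *ᵥ y_q))) * ε * (x ⬝ᵥ x)
      ≤ x ⬝ᵥ (Q + (4 : ℝ) • vecMulVec p p - (4 : ℝ) • vecMulVec q q - (2 : ℝ) • vecMulVec p₀ p₀) *ᵥ x := by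
  rw [dotProduct_splitMatrix_mulVec]
  have h1 := deflation_term_le_of_eq hQ (by norm_num : (0 : ℝ) ≤ 4) hd x
  have h2 := deflation_term_le_of_eq hQ (by norm_num : (0 : ℝ) ≤ 4) hq x
  have h3 := splitForm_ge Q p q p₀ x
  have h4 := hε x
  have h5 : 0 ≤ (1 - (4 * (y_d ⬝ᵥ Q *ᵥ y_d) + 4 * (y_q ⬝ᵥ Q *ᵥ y_q))) * (x ⬝ᵥ Q *ᵥ x - ε * (x ⬝ᵥ x)) :=
    mul_nonneg (by linarith) (by linarith)
  nlinarith [h1, h2, h3, h4, h5]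

/-- Eigenvalue form of `split_floor`: every eigenvalue `λ` (eigenvector `u ≠ 0`) of the split block satisfies
`(1 − τ) ε ≤ λ`.  (Cell use: the odd sector of SPLIT(1, 6e-128) at the top window, `τ⁻ = 9.727e-4`, certified positive.) -/
theorem split_eigenvalue_ge {Q : Matrix ι ι ℝ} (hQ : Q.PosSemidef) (p q p₀ y_d y_q : ι → ℝ)
    (hd : Q *ᵥ y_d = p - p₀) (hq : Q *ᵥ y_q = q) {ε : ℝ} (hε : ∀ x, ε * (x ⬝ᵥ x) ≤ x ⬝ᵥ Q *ᵥ x)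
    (hτ : 4 * (y_d ⬝ᵥ Q *ᵥ y_d) + 4 * (y_q ⬝ᵥ Q *ᵥ y_q) ≤ 1) {u : ι → ℝ} (hu : u ≠ 0) {lam : ℝ}
    (heig : (Q + (4 : ℝ) • vecMulVec p p - (4 : ℝ) • vecMulVec q q - (2 : ℝ) • vecMulVec p₀ p₀) *ᵥ u = lam • u) :
    (1 - (4 * (y_d ⬝ᵥ Q *ᵥ y_d) + 4 * (y_q ⬝ᵥ Q *ᵥ y_q))) * ε ≤ lam := by
  have h := split_floor hQ p q p₀ y_d y_q hd hq hε hτ u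
  rw [heig, dotProduct_smul, smul_eq_mul] at h
  have hnn : 0 ≤ u ⬝ᵥ u := by
    unfold dotProduct
    exact Finset.sum_nonneg fun i _ => mul_self_nonneg (u i)
  have hne : u ⬝ᵥ u ≠ 0 := fun h0 => hu (dotProduct_self_eq_zero.mp h0)
  have hpos : 0 < u ⬝ᵥ u := lt_of_le_of_ne hnn (Ne.symm hne)
  exact le_of_mul_le_mul_right (by linarith) hpos

/-- NO-GO shape for one split: if `Q ⪰ 0` and the split block is negative at some `x`, then the deficit weight of the
surgery exceeds one, `1 < 4⟨y_d, Q y_d⟩ + 4⟨y_q, Q y_q⟩` (for any preimages `Q y_d = p − p₀`, `Q y_q = q`). -/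
theorem one_lt_tau_of_split_neg {Q : Matrix ι ι ℝ} (hQ : Q.PosSemidef) (p q p₀ y_d y_q : ι → ℝ)
    (hd : Q *ᵥ y_d = p - p₀) (hq : Q *ᵥ y_q = q) {x : ι → ℝ}
    (hneg : x ⬝ᵥ (Q + (4 : ℝ) • vecMulVec p p - (4 : ℝ) • vecMulVec q q - (2 : ℝ) • vecMulVec p₀ p₀) *ᵥ x < 0) :
    1 < 4 * (y_d ⬝ᵥ Q *ᵥ y_d) + 4 * (y_q ⬝ᵥ Q *ᵥ y_q) := by
  by_contra h
  push Not at h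
  have h0 : ∀ z : ι → ℝ, (0 : ℝ) * (z ⬝ᵥ z) ≤ z ⬝ᵥ Q *ᵥ z := fun z => by
    rw [zero_mul]; exact form_nonneg hQ z
  have h1 := split_floor hQ p q p₀ y_d y_q hd hq h0 h x
  have h2 : (1 - (4 * (y_d ⬝ᵥ Q *ᵥ y_d) + 4 * (y_q ⬝ᵥ Q *ᵥ y_q))) * 0 * (x ⬝ᵥ x) = 0 := by ring
  linarith

/-- **Multi-split deflation floor.**  A finite superposition of split surgeries (displaced zeros `n ∈ Fin r`, vectors
`p n, q n, p₀ n`, preimages `Q y_d n = p n − p₀ n`, `Q y_q n = q n`) on one parity block `Q ⪰ 0` with spectral floor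
`ε` and total deficit weight `τ := Σ_n (4⟨y_d n, Q y_d n⟩ + 4⟨y_q n, Q y_q n⟩) ≤ 1` is bounded below by `(1 − τ) ε`. -/
theorem multiSplit_floor {Q : Matrix ι ι ℝ} (hQ : Q.PosSemidef) {r : ℕ} (p q p₀ y_d y_q : Fin r → ι → ℝ)
    (hd : ∀ n, Q *ᵥ y_d n = p n - p₀ n) (hq : ∀ n, Q *ᵥ y_q n = q n) {ε : ℝ}
    (hε : ∀ x, ε * (x ⬝ᵥ x) ≤ x ⬝ᵥ Q *ᵥ x)
    (hτ : ∑ n, (4 * (y_d n ⬝ᵥ Q *ᵥ y_d n) + 4 * (y_q n ⬝ᵥ Q *ᵥ y_q n)) ≤ 1) (x : ι → ℝ) :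
    (1 - ∑ n, (4 * (y_d n ⬝ᵥ Q *ᵥ y_d n) + 4 * (y_q n ⬝ᵥ Q *ᵥ y_q n))) * ε * (x ⬝ᵥ x)
      ≤ x ⬝ᵥ Q *ᵥ x + ∑ n, (4 * (p n ⬝ᵥ x) ^ 2 - 4 * (q n ⬝ᵥ x) ^ 2 - 2 * (p₀ n ⬝ᵥ x) ^ 2) := by
  -- per-zero bound: 4⟨p,x⟩² − 4⟨q,x⟩² − 2⟨p₀,x⟩² ≥ −(4⟨y_d,Qy_d⟩ + 4⟨y_q,Qy_q⟩)·xᵀQx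
  have hn : ∀ n, -((4 * (y_d n ⬝ᵥ Q *ᵥ y_d n) + 4 * (y_q n ⬝ᵥ Q *ᵥ y_q n)) * (x ⬝ᵥ Q *ᵥ x))
      ≤ 4 * (p n ⬝ᵥ x) ^ 2 - 4 * (q n ⬝ᵥ x) ^ 2 - 2 * (p₀ n ⬝ᵥ x) ^ 2 := by
    intro n
    have h1 := deflation_term_le_of_eq hQ (by norm_num : (0 : ℝ) ≤ 4) (hd n) x
    have h2 := deflation_term_le_of_eq hQ (by norm_num : (0 : ℝ) ≤ 4) (hq n) x
    have h3 := splitForm_ge Q (p n) (q n) (p₀ n) x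
    nlinarith [h1, h2, h3]
  have hsum := Finset.sum_le_sum fun n (_ : n ∈ Finset.univ) => hn n
  rw [Finset.sum_neg_distrib, ← Finset.sum_mul] at hsum
  have h4 := hε x
  have h5 : 0 ≤ (1 - ∑ n, (4 * (y_d n ⬝ᵥ Q *ᵥ y_d n) + 4 * (y_q n ⬝ᵥ Q *ᵥ y_q n)))
      * (x ⬝ᵥ Q *ᵥ x - ε * (x ⬝ᵥ x)) := mul_nonneg (by linarith) (by linarith)
  nlinarith [hsum, h4, h5]

/-- NO-GO shape for finitely many splits: if `Q ⪰ 0` and a finite superposition of split surgeries is negative at some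
`x`, then its total deficit weight exceeds one. -/
theorem one_lt_tau_of_multiSplit_neg {Q : Matrix ι ι ℝ} (hQ : Q.PosSemidef) {r : ℕ}
    (p q p₀ y_d y_q : Fin r → ι → ℝ) (hd : ∀ n, Q *ᵥ y_d n = p n - p₀ n) (hq : ∀ n, Q *ᵥ y_q n = q n)
    {x : ι → ℝ} (hneg : x ⬝ᵥ Q *ᵥ x + ∑ n, (4 * (p n ⬝ᵥ x) ^ 2 - 4 * (q n ⬝ᵥ x) ^ 2 - 2 * (p₀ n ⬝ᵥ x) ^ 2) < 0) :
    1 < ∑ n, (4 * (y_d n ⬝ᵥ Q *ᵥ y_d n) + 4 * (y_q n ⬝ᵥ Q *ᵥ y_q n)) := by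
  by_contra h
  push Not at h
  have h0 : ∀ z : ι → ℝ, (0 : ℝ) * (z ⬝ᵥ z) ≤ z ⬝ᵥ Q *ᵥ z := fun z => by
    rw [zero_mul]; exact form_nonneg hQ z
  have h1 := multiSplit_floor hQ p q p₀ y_d y_q hd hq h0 h x
  have h2 : (1 - ∑ n, (4 * (y_d n ⬝ᵥ Q *ᵥ y_d n) + 4 * (y_q n ⬝ᵥ Q *ᵥ y_q n))) * 0 * (x ⬝ᵥ x) = 0 := by
    ring
  linarith

end Split

end Summit.RiemannHypothesis.RiemannHypothesis.Theorems.PfPersistenceF2SplitDeflation
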